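import Literature.MathematicalPhysics.QuantumFieldTheory.Balaban1983to89.B8Prop5ExistsZdLan
import HarnessLib

/-!
# `UnitScaleTiltHalvingP1FlatCoreTopStepSocket` — line H (`BirthV10.stub_halvingStep`, stmt-QuantumFields-19200), T2♭-PLAN v1.1 #46 §3 **J4c**, sibling of
# `UnitScaleTiltHalvingP1FlatCoreTopStep`: the Prop.-5 STEP WRAPPER for a generic restriction predicate (`B8Prop5KLevelLetters.hP5_step_of_HFP` with
# `Restr129 ↦ P`).  (Sanity, not re-typed — the dedup gate refuses restatements: the tree's JOIN-B of record `hFP_kLevel_of179_local_RD` IS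
# `hFP_kLevel_ofConstraint_RD` at `P := fun λ => Restr129 L k Λs U₀ (u₁ * gaugeExp λ)` with `hP := restr129_mul_gaugeExp_local … (h179E s hs hq)`;
# checked on the farm in this seat's scratch, rc 0.)

WHY / HONEST FRAMING: see the sibling file.  By-name re-assembly of landed `pub-ymgap`∕`lit-balaban` theorems ([B8] Sect. D–E); no restriction-specific content;
nothing of [4], [3] Prop. 10 or Sect. E's estimates proved here.  Count-neutral helper (`--supports stmt-QuantumFields-19200 --as helper`, ★★OWNER-worded tag, ACK 45);
registry∕binders∕skeleton text untouched (J r4).  YM₃ on T³ = rung R3, NOT the Clay problem; nothing here proves `core`, the stub, the crux, or a mass gap.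

References: T. Bałaban, Commun. Math. Phys. 99 (1985) 75–102 [Balaban1985RegularSpaces] (Prop. 5 (1.107)–(1.110) p.94, (1.86)–(1.88) p.91, (1.38) p.82, (1.29) p.81,
(1.78)–(1.79) p.90).
-/

set_option autoImplicit false

noncomputable section

open NormedSpace Metric Set
open Complex (I)

namespace Summit.QuantumFields.YangMills.Theorems.HalvingP1FlatCoreTopStep

open Literature.MathematicalPhysics.QuantumFieldTheory.Balaban1983to89
open B7Prop1Explicit (e U1 expUnit val_expUnit)
open B7Prop2Explicit (unitaryUnits mem_unitaryUnits unitaryUnits_le_U1)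
open B7Eq78Linearization (conjR)
open B7Eq92Concrete (mgauge mgauge_apply)
open B8Ineq132 (covDerivFwd covDeriv BondTouches)
open B8Eq140Level (SideTouches)
open B8Eq138LandauZd (covLap covDivB QT IsLandau138W)
open B8Eq182Proof (gAd)
open B8Eq184Proof (gaugeExp cfgExp)
open B8Eq188Proof (frakF3)
open B8Prop5KLevelLetters (isLandau138W_gaugeFixed_of_multiplier)

-- `Site` alone could resolve to the torus sites of `Setup.lean`; use the `ℤ^d` sites of `B7Prop1Explicit`.
open B7Prop1Explicit (Site)

variable {d : ℕ} {𝔸 : Type*} [CStarAlgebra 𝔸] [Nontrivial 𝔸]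

/-! ## The step wrapper for a generic restriction predicate (`hP5_step_of_HFP` with `Restr129 ↦ P`) -/

section Step

variable {𝔹 : Type*} [CStarAlgebra 𝔹] [Nontrivial 𝔹]

/-- ★★ **THE PROP.-5 STEP IN PLAIN CURRENCY ⇒ THE SOCKET SHAPE, FOR AN ARBITRARY RESTRICTION PREDICATE** — `B8Prop5KLevelLetters.hP5_step_of_HFP` VERBATIM with the
printed restriction `Restr129 L (m+1) (Λs (m+1)) U₀ (u₁ * gaugeExp lam)` (which that theorem passes through untouched) replaced by `P lam` in the hypothesis `hFP` and in
the conclusion.  Given the level-`m` datum (`U₁ = e^{iηA}` on the bonds of the plaquettes touching `Ω_j`, `A` Hermitian, `|A| ≤ c⋆(Lʲη)⁻¹`) and a fixed point `λ`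
(Hermitian, `= 0` off `Ω₀`, (1.108) at `m+1` levels, the multiplier form of the Landau equation on `Ω₀`, `P λ`): `v := e^{iλ}` is unitary, `= 1` off `Ω₀`, reads
`e^{iλ}` on every bond touching an `Ω_j`, obeys (1.108), `U₁^{v⁻¹}` satisfies the LANDAU CONDITION OF RECORD (1.38) at `m+1` levels, and `P λ`.
[cite: Balaban1985RegularSpaces, Prop. 5 pp.93–94, (1.107)–(1.110) p.94, (1.86)–(1.88) p.91, (1.38) p.82] -/
theorem p5Step_ofConstraint_of_HFP (hd2 : 2 ≤ d) {η : ℝ} (hη : 0 < η) (L m : ℕ) {U₀ : Site d → Fin d → 𝔹ˣ}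
    (hU₀ : ∀ x κ, U₀ x κ ∈ unitaryUnits 𝔹) {cstar α₄ : ℝ} (hs₁ : α₄ ≤ 1 / 84) (hcs : cstar ≤ 1 / 12)
    (Ω : ℕ → Set (Site d)) (Λs : ℕ → ℕ → Set (Site d)) (U₁ : Site d → Fin d → 𝔹ˣ) (A : Site d → Fin d → 𝔹)
    (hdat : ∀ j, j ≤ m → ∀ b ∈ {b : Site d × Fin d | SideTouches (Ω j) b.1 b.2},
      U₁ b.1 b.2 = cfgExp η A b.1 b.2 ∧ IsSelfAdjoint (A b.1 b.2) ∧ ‖A b.1 b.2‖ ≤ cstar * ((L : ℝ) ^ j * η)⁻¹)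
    (P : (Site d → 𝔹) → Prop)
    (hFP : ∃ lam : Site d → 𝔹, (∀ x, IsSelfAdjoint (lam x)) ∧ (∀ x, x ∉ Ω 0 → lam x = 0) ∧
      (∀ j, j ≤ m + 1 → ∀ b ∈ {b : Site d × Fin d | SideTouches (Ω j) b.1 b.2},
        ‖lam b.1‖ ≤ α₄ ∧ ((L : ℝ) ^ j * η) * ‖covDerivFwd η U₀ b.2 lam b.1‖ ≤ α₄) ∧
      (∃ μ : ℕ → Site d → 𝔹, ∀ x ∈ Ω 0,
        covLap η U₀ ((Ω 0).indicator fun y => covDivB η U₀ A y + covLap η U₀ lam y +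
          ((conjR (gaugeExp lam y)⁻¹ (covDivB η U₀ A y) - covDivB η U₀ A y) +
            (gAd (covLap η U₀ lam y) (lam y) - covLap η U₀ lam y) + ∑ μ, frakF3 η U₀ lam A y μ)) x =
          QT L (m + 1) (Λs (m + 1)) U₀ μ x) ∧
      P lam) :
    ∃ (v : Site d → 𝔹ˣ) (lam : Site d → 𝔹), (∀ x, v x ∈ unitaryUnits 𝔹) ∧ (∀ x, x ∉ Ω 0 → v x = 1) ∧
      (∀ j, j ≤ m + 1 → ∀ b ∈ {b : Site d × Fin d | SideTouches (Ω j) b.1 b.2}, (v b.1 : 𝔹) = ((gaugeExp lam b.1 : 𝔹ˣ) : 𝔹) ∧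
        (v (b.1 + e b.2) : 𝔹) = ((gaugeExp lam (b.1 + e b.2) : 𝔹ˣ) : 𝔹)) ∧
      (∀ j, j ≤ m + 1 → ∀ b ∈ {b : Site d × Fin d | SideTouches (Ω j) b.1 b.2},
        ‖lam b.1‖ ≤ α₄ ∧ ((L : ℝ) ^ j * η) * ‖covDerivFwd η U₀ b.2 lam b.1‖ ≤ α₄) ∧
      IsLandau138W L (m + 1) η (Ω 0) (Λs (m + 1)) U₀ (mgauge U₀ v⁻¹ U₁) ∧ v = gaugeExp lam ∧ P lam := by
  obtain ⟨lam, hsa, hoff, h108, hmult, hPlam⟩ := hFP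
  have hE0 : ∀ {y : Site d} {τ : Fin d}, BondTouches (Ω 0) y τ → (y, τ) ∈ {b : Site d × Fin d | SideTouches (Ω 0) b.1 b.2} :=
    fun hb => B8Prop5ExistsZdLan.sideTouches_of_bondTouches_two hd2 hb
  have hα12 : α₄ ≤ 1 / 12 := hs₁.trans (by norm_num)
  have hα70 : α₄ ≤ 1 / 70 := hs₁.trans (by norm_num)
  have hd1 : 0 < d := by omega
  -- (1.108) at level `j = 0` on the bonds touching `Ω₀`
  have h0 : ∀ y τ, BondTouches (Ω 0) y τ → ‖lam y‖ ≤ α₄ ∧ η * ‖covDerivFwd η U₀ τ lam y‖ ≤ α₄ := fun y τ hb => by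
    simpa only [pow_zero, one_mul] using h108 0 (Nat.zero_le _) (y, τ) (hE0 hb)
  have hl : ∀ x ∈ Ω 0, ‖lam x‖ ≤ 1 / 12 := fun x hx => (h0 x ⟨0, hd1⟩ (Or.inl hx)).1.trans hα12
  have hD : ∀ x ∈ Ω 0, ∀ μ, η * ‖covDerivFwd η U₀ μ lam x‖ ≤ 1 / 70 := fun x hx μ => (h0 x μ (Or.inl hx)).2.trans hα70
  have hback : ∀ x ∈ Ω 0, ∀ μ : Fin d, BondTouches (Ω 0) (x - e μ) μ := fun x hx μ => Or.inr (by rwa [sub_add_cancel])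
  have ha : ∀ x ∈ Ω 0, ∀ μ, η * ‖covDeriv η U₀ μ lam x‖ ≤ 1 / 70 := fun x hx μ => by
    rw [B8Eq151V2Divergence.norm_covDeriv_eq (unitaryUnits_le_U1 (hU₀ _ _)) lam]
    exact (h0 _ μ (hback x hx μ)).2.trans hα70
  have hY : ∀ x ∈ Ω 0, ∀ μ, η * ‖conjR (U₀ (x - e μ) μ)⁻¹ (A (x - e μ) μ)‖ ≤ 1 / 12 := fun x hx μ => by
    obtain ⟨-, -, hA⟩ := hdat 0 (Nat.zero_le _) (x - e μ, μ) (hE0 (hback x hx μ))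
    rw [B8Ineq132.norm_conjR ((U1 𝔹).inv_mem (unitaryUnits_le_U1 (hU₀ _ _)))]
    rw [pow_zero, one_mul] at hA
    calc η * ‖A (x - e μ) μ‖ ≤ η * (cstar * η⁻¹) := mul_le_mul_of_nonneg_left hA hη.le
      _ = cstar := by rw [mul_left_comm, mul_inv_cancel₀ hη.ne', mul_one]
      _ ≤ 1 / 12 := hcs
  have hLan : IsLandau138W L (m + 1) η (Ω 0) (Λs (m + 1)) U₀ (mgauge U₀ (gaugeExp lam)⁻¹ (cfgExp η A)) :=
    isLandau138W_gaugeFixed_of_multiplier hη L (m + 1) (Ω 0) (Λs (m + 1)) U₀ A hl hD ha hY hmult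
  have hcongr : ∀ (x : Site d) (μ : Fin d), BondTouches (Ω 0) x μ →
      mgauge U₀ (gaugeExp lam)⁻¹ U₁ x μ = mgauge U₀ (gaugeExp lam)⁻¹ (cfgExp η A) x μ := fun x μ hb => by
    rw [mgauge_apply, mgauge_apply, (hdat 0 (Nat.zero_le _) (x, μ) (hE0 hb)).1]
  refine ⟨gaugeExp lam, lam, fun x => ?_, fun x hx => ?_, fun j _ b _ => ⟨rfl, rfl⟩, h108,
    (B8Eq138LandauZd.isLandau138W_congr η L U₀ hcongr).mpr hLan, rfl, hPlam⟩
  · exact mem_unitaryUnits.mpr (B8Ineq170.exp_I_smul_mem_unitary (hsa x))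
  · exact Units.ext (by rw [gaugeExp, hoff x hx, smul_zero, val_expUnit, NormedSpace.exp_zero, Units.val_one])

end Step



end Summit.QuantumFields.YangMills.Theorems.HalvingP1FlatCoreTopStep

end
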